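/-
Copyright (c) 2026. All rights reserved.
Released under Apache 2.0 license as described in the file LICENSE.
-/
import Literature.AlgebraicGeometry.Pohlmann1968.CorankOneCMTypePowersHodgeConjecture
import Literature.AlgebraicGeometry.Pohlmann1968.DegenerateCMTypeCyclotomic21
import Literature.AlgebraicGeometry.HodgeTheory.WeilClassesSixfolds
import HarnessLib

/-!
# All powers of a simple CM SIXFOLD of corank `≤ 1` — e.g. `X_{21} ⊨ (ℚ(ζ₂₁); Φ₂₁)` — satisfy the Hodge conjecture GIVEN Markman's theorem on
# sixfolds of split Weil type AND the split datum of the sixfold's own Weil-type structures (the sixfold rung of `CorankOne.hodgeConjectureFor_pow`)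

Layer `Literature/AlgebraicGeometry/Pohlmann1968`, namespace `…Pohlmann1968.CorankOne`; the dimension-`6` companion of
`SimpleCMFourfoldPowersHodgeConjecture.hodgeConjectureFor_pow_of_markman` (fourfolds: Markman's fourfold theorem needs no split datum).
THEOREMS ONLY (no definition, no named fact, no `sorry`; D-0026 net debt `0`).

The tree's `CorankOne.hodgeConjectureFor_pow` (Gordon 6.4 ∕ 9.5, Milne, André): for a PRIMITIVE CM type `Φ` of `K` with
`[K:ℚ]/2 ≤ rank Φ` (corank `≤ 1`) and any realisation `A`, the Hodge conjecture holds for every power `Aⁿ` as soon as the rational `(p,p)`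
Weil classes of each Weil-type structure `(A, ι w)` (`w = √-d ∈ 𝓞_K`) are algebraic.  In dimension `6` these structures are sixfolds of Weil
type `(3, d)`, and Markman (arXiv:2502.03415 Thm. 1.5.1; tree fact `Markman2025_weilClasses_algebraic_hyperbolicSixfold`, every `K = ℚ(√-d)`)
gives the Weil classes WHEN the structure is of SPLIT Weil type.  Hence:

* **`hodgeConjectureFor_pow_sixfold_of_markman_of_isSplitWeilType`** — `[K:ℚ] = 12`, `Φ` primitive of rank `≥ 6`, `A ⊨ (K; Φ)`: GIVEN Markman's
  fact and `IsSplitWeilType A (ι w) 3 d` for every Weil-type structure `(A, ι w)` of `A`, `HC(Aⁿ)` for every `n`; `hodgeClasses_algebraic_pow_…` —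
  the cycle clause.
* **`hodgeConjectureFor_pow_twentyOne_of_markman_of_isSplitWeilType`** — the instance `X_{21}`: `(ℚ(ζ₂₁); Φ₂₁)` is primitive of rank EXACTLY
  `6` (`cmTypeRank_Φ₂₁`, DEGENERATE: `not_isNondegenerate_Φ₂₁`), so GIVEN Markman's fact and the split datum of the Weil-type structures of
  `X_{21}`, `HC(X_{21}ⁿ)` for every `n`.

WHAT REMAINS for `X_{21}` (honest register): the split datum — a polarization of `X_{21}` whose `ℚ(√-3)`-Hermitian form has discriminant
`[(-1)³] = [-1] ∈ ℚˣ/Nm(ℚ(√-3)ˣ)` (van Geemen 5.2–5.4).  For a SIMPLE CM sixfold the discriminant of a Rosati polarization is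
`[N_{F⁺/ℚ}(ξ w) · d_{F⁺}]` (`VanGeemen1994/WeilDiscriminantOfCMTypeRealisation`); aiming it at `-1` is arithmetic of the totally real sextic
`ℚ(ζ₂₁)⁺` (norms of totally positive elements modulo `Nm(ℚ(√-3)ˣ)`), NOT in the tree — unlike the product case `Y_{40} × (E′ × E′)` of
`J_{40}` (`VanGeemen1994/SplitWeilTypeFourfoldTimesCMSquare`), where the CM-curve factor supplies a free weight.  Nothing here asserts Markman's
theorem or the split datum.  HC_CM is NOT proved.

## References

* [Gordon1999HodgeAVSurvey] B. Gordon, Thm. 6.4, 9.5, §9.4.3. [cite: Gordon1999HodgeAVSurvey, Thm. 6.4 and 9.5]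
* [Milne2020HodgeClassesAV] J. S. Milne, Thm. 1. [cite: Milne2020HodgeClassesAV, Thm. 1]
* [Markman2025SecantWeil] E. Markman, arXiv:2502.03415, Thm. 1.5.1. [cite: Markman2025SecantWeil, Thm. 1.5.1]
* [Markman2025SurveySecant] E. Markman, arXiv:2509.23403, Thm. 1.2 and §1.1 (Thm. 1.4, André). [cite: Markman2025SurveySecant, Thm. 1.2]
* [vanGeemen1994HodgeAV] B. van Geemen, LNM 1594 (1994), 1.1, Thm. 4.11, 5.2–5.4. [cite: vanGeemen1994HodgeAV, 1.1 and 5.4]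
* [Shimura1998] G. Shimura, §6.2 Thm. 3, §8.2 Prop. 26. [cite: Shimura1998, §8.2 Prop. 26]

## Provenance

Cell `pub-hodgecm2` (COR-CM), KEPT Literature lane `lit-deligne-3` gen 58 (claim X21-POWERS-OF-MARKMAN-SPLIT; count-neutral, own lane), file F58j.
-/

noncomputable section

open CategoryTheory CategoryTheory.Limits NumberField

namespace Literature.AlgebraicGeometry.Pohlmann1968

namespace CorankOne

open Literature.AlgebraicTopology.SingularHomology
open Literature.NumberTheory.ComplexMultiplication
open Literature.AlgebraicGeometry.Motives (AbelianVariety CMType IsSmoothProjective)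
open Literature.AlgebraicGeometry.HodgeTheory
open Literature.AlgebraicGeometry.ComplexMultiplication (IsCMTypeRealisation)

open scoped Classical

section Sixfold

variable {K : Type} [Field K] [NumberField K] [IsCMField K] {Φ : CMType K}
  {A : AbelianVariety ℂ} {ι : 𝓞 K →+* End A} {θ : K →+* Module.End ℂ (complexBetti A.X 1)}

/-- Markman's fact on a sixfold of SPLIT Weil type `(3, d)` gives the rational `(3,3)` classes of its Weil plane. [cite: Markman2025SecantWeil, Thm. 1.5.1] -/
private theorem weilClasses_algebraic_of_markman_of_isSplitWeilType' {B : AbelianVariety ℂ} {ψ : B ⟶ B} {d : ℕ}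
    (hM : Markman2025_weilClasses_algebraic_hyperbolicSixfold) (hS : IsSplitWeilType B ψ 3 d) :
    ∀ c ∈ weilClassesOf B ψ 3 d, IsRationalClass c → IsOfHodgeType (2 * 3) B.X (2 * 3) 3 3 c → c ∈ algebraicClasses B.X 3 := by
  obtain ⟨hW, e, a, ha, ha0, hhyp⟩ := hS
  intro c hcW hcQ hcH
  exact hM d hW.d_pos B ψ hW.dim_eq hW.isSmoothProjective hW.sq_eq e a ha ha0 hhyp c hcQ hcH hcW

/-- **ALL POWERS OF A SIMPLE CM SIXFOLD OF CORANK `≤ 1`, GIVEN MARKMAN'S FACT AND THE SPLIT DATUM OF ITS OWN WEIL-TYPE STRUCTURES.**  For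
`[K:ℚ] = 12`, `Φ` primitive with `6 ≤ rank Φ`, `A ⊨ (K; Φ)`: if `Markman2025_weilClasses_algebraic_hyperbolicSixfold` holds and every Weil-type
structure `(A, ι w)` (`w² = -d`, `d ≥ 1`, `IsWeilType A (ι w) 3 d`) is of SPLIT Weil type, then `HodgeConjectureFor` holds for `Aⁿ = ⨁_{i<n} A`,
every `n` (the sixfold rung of `CorankOne.hodgeConjectureFor_pow`: a Weil-type structure `(A, ι w)` of type `(p, d)` has `2p = dim A = 6`).
[cite: Gordon1999HodgeAVSurvey, Thm. 6.4 and 9.5] [cite: Milne2020HodgeClassesAV, Thm. 1] [cite: Markman2025SecantWeil, Thm. 1.5.1]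
[cite: vanGeemen1994HodgeAV, 1.1 and 5.4] -/
theorem hodgeConjectureFor_pow_sixfold_of_markman_of_isSplitWeilType (hM : Markman2025_weilClasses_algebraic_hyperbolicSixfold)
    (hK : Module.finrank ℚ K = 12) (hrank : 6 ≤ cmTypeRank Φ) (φ₀ : K →+* ℂ) (hprim : IsPrimitive (ℂ ≃+* ℂ) Φ.1 φ₀)
    (hA : IsCMTypeRealisation Φ A ι θ)
    (hS : ∀ (w : 𝓞 K) (d : ℕ), 0 < d → w ^ 2 = -(d : 𝓞 K) → IsWeilType A (ι w) 3 d → IsSplitWeilType A (ι w) 3 d) (n : ℕ) :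
    HodgeConjectureFor (⨁ fun _ : Fin n => A).dim (⨁ fun _ : Fin n => A).X := by
  have hrank' : Module.finrank ℚ K / 2 ≤ cmTypeRank Φ := by rw [hK]; exact hrank
  refine hodgeConjectureFor_pow hrank' φ₀ hprim hA (fun q w d hd hw2 hWT c hcW hcQ hcH => ?_) n
  -- a Weil-type structure `(A, ι w)` of type `(q, d)` has `2q = dim A = 6`
  have hdimK : A.dim = Module.finrank ℚ K / 2 := Motives.schemeDim_eq_holds hA.1
  have hq : q = 3 := by
    have h1 := hWT.dim_eq
    rw [hK] at hdimK
    omega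
  subst hq
  exact weilClasses_algebraic_of_markman_of_isSplitWeilType' hM (hS w d hd hw2 hWT) c hcW hcQ hcH

/-- **The cycle clause**: every rational `(m,m)` class on every power `Aⁿ` is algebraic, under the same hypotheses.
[cite: Gordon1999HodgeAVSurvey, Thm. 6.4 and 9.5] [cite: Markman2025SecantWeil, Thm. 1.5.1] -/
theorem hodgeClasses_algebraic_pow_sixfold_of_markman_of_isSplitWeilType (hM : Markman2025_weilClasses_algebraic_hyperbolicSixfold)
    (hK : Module.finrank ℚ K = 12) (hrank : 6 ≤ cmTypeRank Φ) (φ₀ : K →+* ℂ) (hprim : IsPrimitive (ℂ ≃+* ℂ) Φ.1 φ₀)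
    (hA : IsCMTypeRealisation Φ A ι θ)
    (hS : ∀ (w : 𝓞 K) (d : ℕ), 0 < d → w ^ 2 = -(d : 𝓞 K) → IsWeilType A (ι w) 3 d → IsSplitWeilType A (ι w) 3 d) (n m : ℕ)
    (c : complexBetti (⨁ fun _ : Fin n => A).X (2 * m)) (hcQ : IsRationalClass c)
    (hcH : IsOfHodgeType (⨁ fun _ : Fin n => A).dim (⨁ fun _ : Fin n => A).X (2 * m) m m c) :
    c ∈ algebraicClasses (⨁ fun _ : Fin n => A).X m :=
  (hodgeConjectureFor_pow_sixfold_of_markman_of_isSplitWeilType hM hK hrank φ₀ hprim hA hS n).2 m c hcQ hcH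

end Sixfold

/-! ## The instance `X_{21} ⊨ (ℚ(ζ₂₁); Φ₂₁)` -/

section TwentyOne

open Cyclotomic

variable {L : Type} [Field L] [NumberField L] [IsCyclotomicExtension {21} ℚ L]
  {A : AbelianVariety ℂ} {ι : 𝓞 L →+* End A} {θ : L →+* Module.End ℂ (complexBetti A.X 1)}

/-- **`HC(X_{21}ⁿ)` FOR EVERY `n`, GIVEN MARKMAN'S FACT AND THE SPLIT DATUM OF THE WEIL-TYPE STRUCTURES OF `X_{21}`.**  For every realisation
`A ⊨ (ℚ(ζ₂₁); Φ₂₁)` (a simple, DEGENERATE CM sixfold: `cmTypeRank_Φ₂₁ = 6`, `not_isNondegenerate_Φ₂₁`, `isPrimitive_Φ₂₁`): if Markman's fact holds and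
every Weil-type structure `(A, ι w)` of `A` is split, then `HodgeConjectureFor` holds for `Aⁿ`, every `n`.  What remains is the split datum (a
polarization of `X_{21}` of `ℚ(√-3)`-discriminant `[-1]`), arithmetic of `ℚ(ζ₂₁)⁺` not in the tree. [cite: Gordon1999HodgeAVSurvey, §9.4.3 and Thm. 9.5]
[cite: Markman2025SecantWeil, Thm. 1.5.1] [cite: vanGeemen1994HodgeAV, 5.2 and 5.4] [cite: Shimura1998, §8.2 Prop. 26] -/
theorem hodgeConjectureFor_pow_twentyOne_of_markman_of_isSplitWeilType (hM : Markman2025_weilClasses_algebraic_hyperbolicSixfold)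
    (hA : IsCMTypeRealisation (Φ₂₁ L) A ι θ)
    (hS : ∀ (w : 𝓞 L) (d : ℕ), 0 < d → w ^ 2 = -(d : 𝓞 L) → IsWeilType A (ι w) 3 d → IsSplitWeilType A (ι w) 3 d) (n : ℕ) :
    HodgeConjectureFor (⨁ fun _ : Fin n => A).dim (⨁ fun _ : Fin n => A).X := by
  haveI : IsCMField L := IsCyclotomicExtension.Rat.isCMField L (S := {21}) ⟨21, rfl, by norm_num⟩
  obtain ⟨φ₀⟩ : Nonempty (L →+* ℂ) := inferInstance
  exact hodgeConjectureFor_pow_sixfold_of_markman_of_isSplitWeilType hM (finrank_eq L) (cmTypeRank_Φ₂₁ L).ge φ₀ (isPrimitive_Φ₂₁ L φ₀)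
    hA hS n

end TwentyOne

end CorankOne

end Literature.AlgebraicGeometry.Pohlmann1968

end
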